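import Summits.KontsevichZagierPeriods.KontsevichZagierPeriods.Theses.MultivaluedCoV
import Summits.KontsevichZagierPeriods.KontsevichZagierPeriods.Theorems.HermiteRigidityGenusTwoCycleTransferPushforwardDimOne

/-!
# `LandenIsogenyCoV` (stmt-KontsevichZagierPeriods-2880, route MultivaluedCoV): the Landen/Gauss
AGM step is ONE move of rule (2)

For rationals `a, b > 0`, Newman's substitution `x = φ(t) = (t − ab/t)/2 = (t² − ab)/(2t)` maps
`(0, ∞)` increasingly onto `ℝ`, with `φ′(t) = (t² + ab)/(2t²)`, and
`φ(t)² + ab = (t² + ab)²/(4t²)`, `φ(t)² + ((a+b)/2)² = (t² + a²)(t² + b²)/(4t²)`, whence the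
rule-2 integrand identity
`2/√((t² + a²)(t² + b²)) = (1/√((φ² + ((a+b)/2)²)(φ² + ab))) · |φ′(t)|` on `(0, ∞)`.
Hence for any integral representations `r = [(0,∞), 2/√((t²+a²)(t²+b²))]` and
`r' = [ℝ, 1/√((x²+((a+b)/2)²)(x²+ab))]` of the Kontsevich–Zagier calculus (integrands prescribed
on the domains only), `[r] − [r']` is ONE element of `KZ.changeOfVariablesRel`, along
`Φ(p) = (φ(p 0))`, `DΦ = φ′ • id`, `det DΦ = φ′`: this is `I(a,b) = I((a+b)/2, √(ab))` (Gauss's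
AGM invariance of `∫ dx/√((x²+a²)(x²+b²))`) with all data rational (only `((a+b)/2)²` and `ab`
occur). `LandenIsogenyCoV_proof` concludes the route declaration.

References: D. J. Newman, *A simplified version of the fast algorithms of Brent and Salamin*,
Math. Comp. 44 (1985), 207–210 (reprinted in *Pi: A Source Book*, Springer,
doi:10.1007/978-1-4757-2736-4_57); M. Kontsevich, D. Zagier, *Periods* (2001), §1.2 rule (2).
-/

noncomputable section

open Set MeasureTheory
open Literature.NumberTheory.Transcendental Literature.ModelTheory.ExponentialFields
open Summit.KontsevichZagierPeriods.HermiteRigidity.GenusTwoCycleTransfer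
  (det_smul_id_fin_one hasFDerivAt_fin_one)

namespace Summit.KontsevichZagierPeriods.MultivaluedCoV.LandenIsogenyCoV

/-! ### Scalar facts about Newman's map `φ(t) = (t² − ab)/(2t)` -/

/-- `φ(t)² + ab = (t² + ab)²/(4t²)` for `t ≠ 0`. [cite: Newman1985, §2] -/
theorem newman_sq_add_prod (a b t : ℝ) (ht : t ≠ 0) :
    ((t ^ 2 - a * b) / (2 * t)) ^ 2 + a * b = (t ^ 2 + a * b) ^ 2 / (4 * t ^ 2) := by
  field_simp
  ring

/-- `φ(t)² + ((a+b)/2)² = (t² + a²)(t² + b²)/(4t²)` for `t ≠ 0`. [cite: Newman1985, §2] -/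
theorem newman_sq_add_mean_sq (a b t : ℝ) (ht : t ≠ 0) :
    ((t ^ 2 - a * b) / (2 * t)) ^ 2 + ((a + b) / 2) ^ 2 =
      (t ^ 2 + a ^ 2) * (t ^ 2 + b ^ 2) / (4 * t ^ 2) := by
  field_simp
  ring

/-- `φ` has derivative `φ′(t) = (t² + ab)/(2t²)` at every `t ≠ 0` (quotient rule). [folklore] -/
theorem hasDerivAt_newman (a b t : ℝ) (ht : t ≠ 0) :
    HasDerivAt (fun s : ℝ => (s ^ 2 - a * b) / (2 * s)) ((t ^ 2 + a * b) / (2 * t ^ 2)) t := by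
  have hnum : HasDerivAt (fun s : ℝ => s ^ 2 - a * b) (2 * t) t := by
    simpa using ((hasDerivAt_pow 2 t).sub_const (a * b))
  have hden : HasDerivAt (fun s : ℝ => 2 * s) 2 t := by
    simpa using ((hasDerivAt_id t).const_mul (2 : ℝ))
  refine (hnum.div hden (mul_ne_zero two_ne_zero ht)).congr_deriv ?_
  field_simp
  ring

/-- `φ` is injective on `(0, ∞)`: `φ(s) = φ(t)` forces `(s − t)(st + ab) = 0`, and `st + ab > 0`.
[cite: Newman1985, §2] -/
theorem newman_injOn (a b : ℝ) (hab : 0 < a * b) {s t : ℝ} (hs : 0 < s) (ht : 0 < t)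
    (h : (s ^ 2 - a * b) / (2 * s) = (t ^ 2 - a * b) / (2 * t)) : s = t := by
  rw [div_eq_div_iff (mul_ne_zero two_ne_zero hs.ne') (mul_ne_zero two_ne_zero ht.ne')] at h
  have hfac : (s - t) * (s * t + a * b) = 0 := by linear_combination h / 2
  have hpos : 0 < s * t + a * b := by positivity
  rcases mul_eq_zero.mp hfac with h0 | h0
  · linarith
  · exact absurd h0 hpos.ne'

/-- `φ` maps `(0, ∞)` ONTO `ℝ`: `y = φ(t)` for `t = y + √(y² + ab) > 0`. [cite: Newman1985, §2] -/
theorem exists_newman_eq (a b : ℝ) (hab : 0 < a * b) (y : ℝ) :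
    ∃ t : ℝ, 0 < t ∧ (t ^ 2 - a * b) / (2 * t) = y := by
  set s : ℝ := Real.sqrt (y ^ 2 + a * b) with hs_def
  have hs2 : s ^ 2 = y ^ 2 + a * b := by
    rw [hs_def, Real.sq_sqrt (by positivity)]
  have hsy : |y| < s := by
    rw [hs_def, ← Real.sqrt_sq_eq_abs]
    exact Real.sqrt_lt_sqrt (sq_nonneg y) (by linarith)
  have ht : 0 < y + s := by
    have := neg_abs_le y
    linarith
  refine ⟨y + s, ht, ?_⟩
  rw [div_eq_iff (mul_ne_zero two_ne_zero ht.ne')]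
  linear_combination hs2

/-- **The rule-2 integrand identity** of the Landen/AGM move on `(0, ∞)`:
`2/√((t²+a²)(t²+b²)) = (1/√((φ(t)² + ((a+b)/2)²)(φ(t)² + ab))) · |φ′(t)|`.
[cite: Newman1985, §2] -/
theorem jacobian_identity (a b : ℝ) (hab : 0 < a * b) {t : ℝ} (ht : 0 < t) :
    2 / Real.sqrt ((t ^ 2 + a ^ 2) * (t ^ 2 + b ^ 2)) =
      1 / Real.sqrt ((((t ^ 2 - a * b) / (2 * t)) ^ 2 + ((a + b) / 2) ^ 2) *
          (((t ^ 2 - a * b) / (2 * t)) ^ 2 + a * b)) *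
        |(t ^ 2 + a * b) / (2 * t ^ 2)| := by
  have ht0 : t ≠ 0 := ht.ne'
  set P : ℝ := (t ^ 2 + a ^ 2) * (t ^ 2 + b ^ 2) with hP_def
  have hP : 0 < P := by positivity
  have hQ : 0 < t ^ 2 + a * b := by positivity
  have hsP : 0 < Real.sqrt P := Real.sqrt_pos.mpr hP
  rw [newman_sq_add_mean_sq a b t ht0, newman_sq_add_prod a b t ht0, abs_of_pos (by positivity)]
  have hprod : P / (4 * t ^ 2) * ((t ^ 2 + a * b) ^ 2 / (4 * t ^ 2)) =
      P * ((t ^ 2 + a * b) / (4 * t ^ 2)) ^ 2 := by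
    field_simp
  have hq : 0 ≤ (t ^ 2 + a * b) / (4 * t ^ 2) := by positivity
  rw [← hP_def, hprod, Real.sqrt_mul hP.le, Real.sqrt_sq hq]
  field_simp
  ring

/-! ### Newman's map on `ℝ¹ = Fin 1 → ℝ` -/

/-- `p ↦ φ(p 0)` is a `ℚ`-semialgebraic function on every `ℚ`-semialgebraic subset of
`{p | 0 < p 0} ⊆ ℝ¹` (a quotient of `ℚ`-polynomials with non-vanishing denominator), for rational
`a, b`. [cite: BochnakCosteRoy1998, §2.2] -/
theorem isSemialgebraicFunOn_newman (a b : ℚ) {σ : Set (Fin 1 → ℝ)} (hσ : IsSemialgebraic ℚ σ)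
    (hpos : ∀ p ∈ σ, 0 < p 0) :
    IsSemialgebraicFunOn ℚ σ (fun p => (p 0 ^ 2 - (a : ℝ) * b) / (2 * p 0)) := by
  have h := isSemialgebraicFunOn_aeval_div_aeval hσ
    (MvPolynomial.X 0 ^ 2 - MvPolynomial.C (a * b) : MvPolynomial (Fin 1) ℚ)
    (MvPolynomial.C 2 * MvPolynomial.X 0 : MvPolynomial (Fin 1) ℚ)
    (fun p hp => by simpa using (hpos p hp).ne')
  refine h.congr fun p _ => ?_
  simp

/-- **The image of `(0, ∞)` under Newman's map is all of `ℝ`** (as subsets of `ℝ¹`).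
[cite: Newman1985, §2] -/
theorem image_newman (a b : ℝ) (hab : 0 < a * b) :
    (fun (p : Fin 1 → ℝ) (_ : Fin 1) => (p 0 ^ 2 - a * b) / (2 * p 0)) ''
        {p : Fin 1 → ℝ | 0 < p 0} = Set.univ := by
  refine eq_univ_of_forall fun X => ?_
  obtain ⟨t, ht, htX⟩ := exists_newman_eq a b hab (X 0)
  refine ⟨fun _ => t, ht, ?_⟩
  funext i
  rw [Fin.fin_one_eq_zero i]
  exact htX

/-! ### The item: one move of rule (2) -/

/-- **`LandenIsogenyCoV`** (stmt-KontsevichZagierPeriods-2880): for rationals `a, b > 0` and any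
integral representations `r = [(0,∞), 2/√((t²+a²)(t²+b²))]`, `r' = [ℝ, 1/√((x²+((a+b)/2)²)(x²+ab))]`
of the KZ calculus (integrands prescribed on the domains only), `[r] − [r'] ∈ KZ.changeOfVariablesRel`
— ONE change of variables (rule 2) along Newman's map `Φ(p) = (φ(p 0))`, `φ(t) = (t² − ab)/(2t)`:
`Φ` is `ℚ`-semialgebraic and injective on `(0,∞)` with image `ℝ`, `DΦ = φ′ • id`, `det DΦ = φ′`,
and the Jacobian identity is `jacobian_identity`. This is the Landen/Gauss AGM step
`I(a, b) = I((a+b)/2, √(ab))` read inside the calculus.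
[cite: Newman1985, §2; KontsevichZagier2001, §1.2 rule (2)] -/
theorem LandenIsogenyCoV_proof :
    Summit.KontsevichZagierPeriods.KontsevichZagierPeriods.Theses.MultivaluedCoV.LandenIsogenyCoV := by
  unfold Summit.KontsevichZagierPeriods.KontsevichZagierPeriods.Theses.MultivaluedCoV.LandenIsogenyCoV
  intro a b ha hb r r' h1 h2 h3 h4
  have hab : 0 < (a : ℝ) * b := by positivity
  set Φ : (Fin 1 → ℝ) → (Fin 1 → ℝ) :=
    fun p _ => (p 0 ^ 2 - (a : ℝ) * b) / (2 * p 0) with hΦ_def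
  set Φ' : (Fin 1 → ℝ) → ((Fin 1 → ℝ) →L[ℝ] (Fin 1 → ℝ)) := fun p =>
    ((p 0 ^ 2 + (a : ℝ) * b) / (2 * p 0 ^ 2)) • ContinuousLinearMap.id ℝ (Fin 1 → ℝ) with hΦ'_def
  have hdom : ∀ p ∈ r.domain, 0 < p 0 := fun p hp => by
    rw [h1] at hp
    exact hp
  -- Φ is a semialgebraic map, injective on σ, with derivative Φ' within σ
  have hΦsa : IsSemialgebraicMapOn ℚ r.domain Φ :=
    IsSemialgebraicMapOn.of_forall r.isSemialgebraic_domain fun _ =>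
      isSemialgebraicFunOn_newman a b r.isSemialgebraic_domain hdom
  have hderiv : ∀ p ∈ r.domain, HasFDerivWithinAt Φ (Φ' p) r.domain p := fun p hp =>
    (hasFDerivAt_fin_one (fun t : ℝ => (t ^ 2 - (a : ℝ) * b) / (2 * t)) _ p
      (hasDerivAt_newman (a : ℝ) b (p 0) (hdom p hp).ne')).hasFDerivWithinAt
  have hinj : InjOn Φ r.domain := by
    intro p hp q hq h
    have h' : (p 0 ^ 2 - (a : ℝ) * b) / (2 * p 0) = (q 0 ^ 2 - (a : ℝ) * b) / (2 * q 0) :=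
      congrFun h 0
    have hpq : p 0 = q 0 := newman_injOn (a : ℝ) b hab (hdom p hp) (hdom q hq) h'
    funext i
    rw [Fin.fin_one_eq_zero i]
    exact hpq
  have himage : r'.domain = Φ '' r.domain := by
    rw [h3, h1]
    exact (image_newman (a : ℝ) b hab).symm
  have hdet : ∀ p, (Φ' p).det = (p 0 ^ 2 + (a : ℝ) * b) / (2 * p 0 ^ 2) :=
    fun p => det_smul_id_fin_one _
  -- the Jacobian identity on σ
  have hjac : ∀ p ∈ r.domain, r.integrand p = r'.integrand (Φ p) * |(Φ' p).det| := by
    intro p hp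
    have hmem : Φ p ∈ r'.domain := himage ▸ mem_image_of_mem Φ hp
    rw [h2 hp, h4 hmem, hdet p]
    exact jacobian_identity (a : ℝ) b hab (hdom p hp)
  exact ⟨1, r, r', Φ, Φ', hΦsa, hderiv, hinj, himage, hjac, rfl⟩

end Summit.KontsevichZagierPeriods.MultivaluedCoV.LandenIsogenyCoV

end
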